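import Mathlib.Algebra.MvPolynomial.Basic
import Mathlib.RingTheory.MvPolynomial.Basic
import Mathlib.Data.NNReal.Basic
import Mathlib.Data.Nat.Log
import Mathlib.Algebra.Ring.Parity
import Mathlib.Data.Finset.Powerset
import Mathlib.Logic.Equiv.Defs
import Literature.Computability.AlgebraicComplexity.ArithCircuit

/-!
# Route DivisionGap — crux `TriangularDimersDivisionEasy` (stmt-ValiantsHypothesis-5067): shared vocabulary of
the line `Sketch` (idea card `hight-ising-face`: the odd-join / Ising face lift)

Definitions only (plus the involutivity lemma that packages the variable swap as an `Equiv`); no statement of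
the line is asserted here.  They are the objects the line posits, factored out of the lead's checked skeleton
`Cruxes/TriangularDimersDivisionEasy/Lines/Sketch.lean` so that every registered stub — each landed as its own
`--supports stmt-ValiantsHypothesis-5067` file under `Theorems/` — and the final composition speak about the SAME
constants.  Everything lives in the crux's own polynomial ring `ℝ≥0[x_(v,w) : v, w ∈ Fin n × Fin n]`
(one variable per ORDERED pair of vertices of the `n × n` rhombus `R_n` of the triangular lattice):

* `IsFwd e`, `edges n` — the forward orientation `(v, v + d)`, `d ∈ {(1,0), (0,1), (1,-1)}`, of the three edge
  directions of the crux's adjacency (one representative per undirected edge of `R_n`);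
* `deg J v`, `oddCovers n`, `evenSubgraphs n` — degree of a vertex in an edge set, spanning edge sets with all
  degrees odd (odd joins of `V`; the minimal ones are the perfect matchings) resp. all degrees even (cycle space);
* `yv e = x_e · x_(e.swap)` — the crux's doubled edge variable;
* `oddJoin n = Σ_{J odd} Π_{e ∈ J} y_e · Π_{e ∉ J} (1 + y_e)` — the odd-join polynomial in the chart of the card
  (`u = 1`): the numerator of the all-spin correlator `Z⟨Π_v σ_v⟩` of the ferromagnetic Ising model on `R_n` with
  `tanh J_e = y_e / (1 + y_e)`; its lowest homogeneous component is the crux's `D_n` (stub `stub_faceIdentity`);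
* `oddJoinSplit n = Σ_{J odd} Π_{e ∈ J} x_e · Π_{e ∉ J} x_(e.swap)` and
  `evenSplit n = Σ_{H even} Π_{e ∈ H} x_e · Π_{e ∉ H} x_(e.swap)` — the same sums in SPLIT variables (the forward
  variable `x_e` as the "disagree"/odd weight, the backward variable `x_(e.swap)` as the "agree"/even weight);
  `evenSplit` is the even-subgraph (high-temperature Ising, cycle-space) polynomial of `R_n`, i.e. by planar duality
  the sourceless ferromagnetic Ising partition function of the dual region in Boltzmann coordinates;
* `pm0 n` (the column matching `(i,2j)–(i,2j+1)`), `swapFun n` / `swapVar n` (exchange `x_e ↔ x_(e.swap)` on the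
  edges of `pm0 n`; for even `n` it carries `evenSplit n` to `oddJoinSplit n`), `substY n` (the monotone chart map
  `x_e ↦ y_e`, `x_(e.swap) ↦ 1 + y_e` on edges, identity elsewhere; it carries `oddJoinSplit n` to `oddJoin n`);
* `bound c n = 2 ^ ((log₂ n + c) ^ c)` (the crux's threshold), `DivEasy F` (quasi-polynomial division complexity of
  a family in the Hrubeš–Yehudayoff normal form `F · h = g`, `h ≠ 0`); the line's open stub is `DivEasy oddJoin`
  and its sourceless strengthening `DivEasy evenSplit` (written out, never named: they are the line's targets, not facts).

Sources: Fomin–Grigoriev–Koshevoy 2014 Rem. 1.5 (the question), Hrubeš–Yehudayoff 2021 §6 (normal form),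
van der Waerden's high-temperature expansion (odd joins / even subgraphs). [cite: FominGrigorievKoshevoy2014, Rem. 1.5]
-/

-- `Summit.ValiantsHypothesis.ValiantsHypothesis.…` is the tree's mandated single-conjunct layout (Sub = Summit),
-- so the duplicated namespace component is intended.
set_option linter.dupNamespace false

namespace Summit.ValiantsHypothesis.ValiantsHypothesis.Theorems.TriangularDimersDivisionEasy.OddJoin

open scoped BigOperators NNReal
open Finset MvPolynomial Literature.Computability.AlgebraicComplexity

noncomputable section

/-- Vertices of the `n × n` rhombus `R_n`. [folklore] -/
abbrev Vtx (n : ℕ) : Type := Fin n × Fin n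

/-- Variables of the crux's polynomial ring: ordered pairs of vertices (`x_(v, w)`). [folklore] -/
abbrev Var (n : ℕ) : Type := Vtx n × Vtx n

/-- FORWARD orientation of the crux's adjacency: `e = (v, w)` with `w = v + (1,0)`, `v + (0,1)` or `v + (1,-1)`
(exactly the 1st, 3rd and 5th of the crux's six disjuncts; the other three are their reversals). [folklore] -/
def IsFwd {n : ℕ} (e : Var n) : Prop :=
  ((e.1.1 : ℕ) + 1 = e.2.1 ∧ (e.1.2 : ℕ) = e.2.2) ∨
  ((e.1.1 : ℕ) = e.2.1 ∧ (e.1.2 : ℕ) + 1 = e.2.2) ∨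
  ((e.1.1 : ℕ) + 1 = e.2.1 ∧ (e.2.2 : ℕ) + 1 = e.1.2)

/-- `IsFwd` is decidable (a disjunction of equalities of naturals). [folklore] -/
instance instDecidableIsFwd {n : ℕ} (e : Var n) : Decidable (IsFwd e) := by
  unfold IsFwd; infer_instance

/-- The edge set of `R_n`, one forward ordered pair per undirected edge. [folklore] -/
def edges (n : ℕ) : Finset (Var n) := univ.filter IsFwd

/-- Degree of the vertex `v` in the edge set `J` (number of members of `J` with `v` as an endpoint). [folklore] -/
def deg {n : ℕ} (J : Finset (Var n)) (v : Vtx n) : ℕ := (J.filter fun e => e.1 = v ∨ e.2 = v).card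

/-- Spanning edge sets of `R_n` with all degrees ODD (odd joins of the whole vertex set; `|J| ≥ n²/2` with
equality exactly for the perfect matchings). [folklore] -/
def oddCovers (n : ℕ) : Finset (Finset (Var n)) :=
  (edges n).powerset.filter fun J => ∀ v, Odd (deg J v)

/-- Edge sets of `R_n` with all degrees EVEN (the cycle space). [folklore] -/
def evenSubgraphs (n : ℕ) : Finset (Finset (Var n)) :=
  (edges n).powerset.filter fun H => ∀ v, Even (deg H v)

/-- The crux's doubled edge variable `y_e = x_e · x_(e.swap)`. [folklore] -/
def yv {n : ℕ} (e : Var n) : MvPolynomial (Var n) ℝ≥0 := X e * X e.swap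

/-- The ODD-JOIN POLYNOMIAL `Σ_{J odd} Π_{e ∈ J} y_e · Π_{e ∈ E ∖ J} (1 + y_e)`: numerator of the all-spin
correlator of the ferromagnetic Ising model on `R_n` with `tanh J_e = y_e/(1+y_e)` (van der Waerden's
high-temperature expansion). [folklore] -/
def oddJoin (n : ℕ) : MvPolynomial (Var n) ℝ≥0 :=
  ∑ J ∈ oddCovers n, (∏ e ∈ J, yv e) * ∏ e ∈ edges n \ J, (1 + yv e)

/-- The odd-join polynomial in SPLIT variables: `Σ_{J odd} Π_{e ∈ J} x_e · Π_{e ∈ E ∖ J} x_(e.swap)`. [folklore] -/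
def oddJoinSplit (n : ℕ) : MvPolynomial (Var n) ℝ≥0 :=
  ∑ J ∈ oddCovers n, (∏ e ∈ J, X e) * ∏ e ∈ edges n \ J, X e.swap

/-- The EVEN-SUBGRAPH POLYNOMIAL in split variables: `Σ_{H even} Π_{e ∈ H} x_e · Π_{e ∈ E ∖ H} x_(e.swap)`
(high-temperature / cycle-space generating polynomial of `R_n`; by planar duality the sourceless ferromagnetic
Ising partition function of the dual region in Boltzmann coordinates). [folklore] -/
def evenSplit (n : ℕ) : MvPolynomial (Var n) ℝ≥0 :=
  ∑ H ∈ evenSubgraphs n, (∏ e ∈ H, X e) * ∏ e ∈ edges n \ H, X e.swap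

/-- The crux's threshold `2 ^ ((log₂ n + c) ^ c)`. [folklore] -/
def bound (c n : ℕ) : ℕ := 2 ^ ((Nat.log 2 n + c) ^ c)

/-- QUASI-POLYNOMIAL DIVISION COMPLEXITY of a family `F n ∈ ℝ≥0[x_(v,w)]` in the normal form `F · h = g`:
some non-zero monotone `h` makes both `F n · h` and `h` computable by monotone fan-in-two circuits of size
`≤ 2 ^ ((log₂ n + c) ^ c)` (Hrubeš–Yehudayoff 2021 §6; the crux is `DivEasy (D_n)`). [folklore] -/
def DivEasy (F : ∀ n : ℕ, MvPolynomial (Var n) ℝ≥0) : Prop :=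
  ∃ c : ℕ, ∀ n : ℕ, ∃ h : MvPolynomial (Var n) ℝ≥0,
    h ≠ 0 ∧ complexity (F n * h) + complexity h ≤ bound c n

/-- The reference perfect matching of `R_n` (`n` even): the column pairs `(i, 2j)–(i, 2j+1)`, as forward edges.
[folklore] -/
def pm0 (n : ℕ) : Finset (Var n) :=
  (edges n).filter fun e => (e.1.1 : ℕ) = e.2.1 ∧ (e.1.2 : ℕ) + 1 = e.2.2 ∧ Even (e.1.2 : ℕ)

/-- The variable swap `x_e ↔ x_(e.swap)` on the edges of `pm0 n`, identity elsewhere. [folklore] -/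
def swapFun (n : ℕ) (e : Var n) : Var n := if e ∈ pm0 n ∨ e.swap ∈ pm0 n then e.swap else e

/-- `swapFun n` is an involution. [folklore] -/
theorem swapFun_involutive (n : ℕ) : Function.Involutive (swapFun n) := by
  intro e
  unfold swapFun
  by_cases h : e ∈ pm0 n ∨ e.swap ∈ pm0 n
  · rw [if_pos h]
    have h' : e.swap ∈ pm0 n ∨ e.swap.swap ∈ pm0 n := by
      rw [Prod.swap_swap]; exact h.symm
    rw [if_pos h', Prod.swap_swap]
  · rw [if_neg h, if_neg h]

/-- The swap as a permutation of the variables. [folklore] -/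
def swapVar (n : ℕ) : Var n ≃ Var n := (swapFun_involutive n).toPerm _

/-- The monotone chart map from split variables to the card's chart: `x_e ↦ y_e` and `x_(e.swap) ↦ 1 + y_e` for
forward edges `e`, identity on non-edge variables. [folklore] -/
def substY (n : ℕ) (e : Var n) : MvPolynomial (Var n) ℝ≥0 :=
  if IsFwd e then yv e else if IsFwd e.swap then 1 + yv e.swap else X e

end

end Summit.ValiantsHypothesis.ValiantsHypothesis.Theorems.TriangularDimersDivisionEasy.OddJoin
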